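import Summits.MatrixMultiplication.MatrixMultiplication.Theses.DefinableSTPPDichotomy
import Summits.MatrixMultiplication.MatrixMultiplication.Theorems.PairwiseCurvedTilingsLC.Negative.LonelyTranslates
import Summits.MatrixMultiplication.MatrixMultiplication.Theorems.PairwiseCurvedTilingsLC.Negative.UniformEta
import Summits.MatrixMultiplication.MatrixMultiplication.Theorems.PairwiseCurvedTilingsLC.Negative.PairwiseCurvedTilingsLCThinBlocks
import Summits.MatrixMultiplication.MatrixMultiplication.Theorems.PairwiseCurvedTilingsLC.Negative.PairwiseCurvedTilingsLCFalseOfEtaleOpenFacts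
import Summits.MatrixMultiplication.MatrixMultiplication.Theorems.PairwiseCurvedTilingsLC.Negative.PairwiseCurvedTilingsLCFalseOfDefinableTranslateRecurrenceLC
import Summits.MatrixMultiplication.MatrixMultiplication.Theorems.DefinableSTPPDichotomyHexagonClearanceROfRecurrence
import Literature.ModelTheory.PseudofiniteFields.DefinableTranslateRecurrenceLCProofs
import Literature.ModelTheory.PseudofiniteFields.EtaleOpenTopologyProofs
import Literature.ModelTheory.PseudofiniteFields.DefinableSetsFiniteFieldsDecomposition

/-!
# STRATEGY CENSUS r1 (Lean side) — crux `PairwiseCurvedTilingsLC` (stmt-MatrixMultiplication-17883)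

EXEMPT-46 re-exam (BC2-redirect test (a)–(d)), crux-strategist seat
`planner-cstrat-stmt-MatrixMultiplication-17883-r1-0`, 2026-08-17.  Companion of
`STRATEGY-CENSUS.md` (same directory): every decomposition `X₁ ∧ … ∧ X_k → PairwiseCurvedTilingsLC`
attempted is TYPED here with its assembly PROVED ((b) of the test), together with the theorem that
makes (d) — "a plan for every open piece" — unsatisfiable in good faith:

* §0 `no_redirect₂/₃` — the crux is REFUTED conditionally on published theorems
  (`PairwiseCurvedTilingsLC_false_of_EtaleOpenFacts`, landed p150554: Johnson–Tran–Walsberg–Ye 2024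
  Thm 7.1, Walsberg–Ye 2023 Thm C (1)/D, Chatzidakis–van den Dries–Macintyre 1992), hence for EVERY
  proved assembly `X₁ → … → X_k → LC` the same facts refute some piece: `EtaleOpenFacts → ¬X₁ ∨ … ∨ ¬X_k`.
* §1 D-A WITNESS split (the constructive split: exhibit formulas `Φ`, check the clause, count the
  mass; prime fields): `lc_of_witness : ClauseOK Φ → MassOK Φ → LC`, `witness_dead`.
* §2 D-B PORE-SET split (gen-0 census, re-typed): `LC_of_subs : PorosityCriterion →
  PorousDefinablePackingLC → LC`; the second piece has the crux's witnesses.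
* §3 D-C FAT bridge: `LCFat → LC` is trivial, so the bridge `LCFat ∧ (LCFat → LC)` fails (c).
* §4 D-D FACTS bridge: `¬EtaleOpenFacts ∧ (¬EtaleOpenFacts → LC) → LC`; piece 1 says a published
  theorem (as rendered) is false.
* §5 D-E SHADOW bridge (sharpest necessary condition): `LC → ¬PorosityShadowBound` (proved, k1's
  `notLC_of_shadowBound`), split `¬PorosityShadowBound ∧ (¬PorosityShadowBound → LC)`; piece 1 is
  refuted by the facts (`porosityShadowBound_of_facts`).
* §6 D-F PATTERN bridge: `LC → LCPatternIJ` (clause weakened to the one 2-label pattern the kill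
  uses), split `LCPatternIJ ∧ (LCPatternIJ → LC)`.
* §7 `facts_decide_route : EtaleOpenFacts → ¬LC ∧ HexagonClearanceR` (both cruxes decided by the facts).
* §8 `sphere_patternIJ_zmod` — the sphere family satisfies the `i = j` pattern (anisotropy via cross products).
* §9 `lcPatternIJ_holds : LCPatternIJ` (formulas by the `DefinablePredicates` toolkit, `|u^⊥| = p²` by
  rank–nullity, `|sphere| ≥ p² − 2p` by stereographic injection, primes `p ≡ 3 (4)` by Dirichlet);
  `patternBridge_piece_dead`, `onePattern_version_unrefutable` (tightness of the negative lemma).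

Nothing in this file is a proposal; `sorry`-free.
-/

set_option linter.dupNamespace false
set_option linter.unusedVariables false

namespace Summit.MatrixMultiplication.MatrixMultiplication.Cruxes.PairwiseCurvedTilingsLC.StrategyCensusR1

open Finset
open scoped Pointwise
open FirstOrder FirstOrder.Language FirstOrder.Ring
open Summit.MatrixMultiplication.MatrixMultiplication.Theses.DefinableSTPPDichotomy
open Summit.MatrixMultiplication.MatrixMultiplication.Theorems.PairwiseCurvedTilingsLC.Negative
open Literature.ModelTheory.PseudofiniteFields

/-! ## §0 The obstruction to (d): every proved assembly has a refuted piece -/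

/-- Binary form. -/
theorem no_redirect₂ {X₁ X₂ : Prop} (assembly : X₁ → X₂ → PairwiseCurvedTilingsLC)
    (hF : EtaleOpenFacts) : ¬ X₁ ∨ ¬ X₂ := by
  by_contra h
  simp only [not_or, not_not] at h
  exact PairwiseCurvedTilingsLC_false_of_EtaleOpenFacts hF (assembly h.1 h.2)

/-- Ternary form. -/
theorem no_redirect₃ {X₁ X₂ X₃ : Prop} (assembly : X₁ → X₂ → X₃ → PairwiseCurvedTilingsLC)
    (hF : EtaleOpenFacts) : ¬ X₁ ∨ ¬ X₂ ∨ ¬ X₃ := by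
  by_contra h
  simp only [not_or, not_not] at h
  exact PairwiseCurvedTilingsLC_false_of_EtaleOpenFacts hF (assembly h.1 h.2.1 h.2.2)

/-- List form (any arity). -/
theorem no_redirect_list (Xs : List Prop) (assembly : (∀ X ∈ Xs, X) → PairwiseCurvedTilingsLC)
    (hF : EtaleOpenFacts) : ∃ X ∈ Xs, ¬ X := by
  by_contra h
  simp only [not_exists, not_and, not_not] at h
  exact PairwiseCurvedTilingsLC_false_of_EtaleOpenFacts hF (assembly h)

/-- The trust base spelled out: three published theorems (pseudo-finite special cases) — and the
second, older conditional refutation is subsumed (`H` is itself proved from the same facts). -/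
theorem trust_base (h71 : JohnsonTranWalsbergYe2024_thm71_psf) (hWY : WalsbergYe2023_thmC_psf)
    (hCDM : ChatzidakisVanDenDriesMacintyre1992_mainTheorem) :
    ¬ PairwiseCurvedTilingsLC ∧ DefinableTranslateRecurrenceLC :=
  ⟨not_PairwiseCurvedTilingsLC_of_facts h71 hWY hCDM,
    DefinableTranslateRecurrenceLC_of_facts h71 hWY hCDM⟩

/-- **Trust base as of 14:20Z: TWO named facts.**  `JohnsonTranWalsbergYe2024_thm71_psf` is now
PROVED in the tree (`JohnsonTranWalsbergYe2024_thm71_psf_holds`, `EtaleOpenTopologyProofs.lean`,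
axioms standard), so the crux is refuted conditionally on Walsberg–Ye Thm C (1)/D (psf) and the CDM
Main Theorem (itself from CDM Prop. (2.7) + (3.3)) only. -/
theorem not_LC_of_two_facts (hWY : WalsbergYe2023_thmC_psf)
    (hCDM : ChatzidakisVanDenDriesMacintyre1992_mainTheorem) : ¬ PairwiseCurvedTilingsLC :=
  not_PairwiseCurvedTilingsLC_of_facts JohnsonTranWalsbergYe2024_thm71_psf_holds hWY hCDM

/-- … and on Walsberg–Ye Thm C psf + CDM Prop. (2.7) + Prop. (3.3) (the Main Theorem is proved from
the two propositions in the tree). -/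
theorem not_LC_of_WY_prop27_prop33 (hWY : WalsbergYe2023_thmC_psf)
    (h27 : ChatzidakisVanDenDriesMacintyre1992_prop27)
    (h33 : ChatzidakisVanDenDriesMacintyre1992_prop33) : ¬ PairwiseCurvedTilingsLC :=
  not_LC_of_two_facts hWY (ChatzidakisVanDenDriesMacintyre1992_mainTheorem_holds_of h33 h27)

/-! ## §1 D-A — the WITNESS split (constructive: formulas, clause, mass) -/

/-- A tuple of ring formulas of the crux's shape. -/
structure Tuple where
  e : ℕ
  m : ℕ
  k : ℕ
  φI : Language.ring.Formula (Fin e ⊕ Fin k)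
  φA : Language.ring.Formula ((Fin e ⊕ Fin m) ⊕ Fin k)
  φB : Language.ring.Formula ((Fin e ⊕ Fin m) ⊕ Fin k)
  φC : Language.ring.Formula ((Fin e ⊕ Fin m) ⊕ Fin k)

section Realised

variable (Φ : Tuple) (F : Type) [Field F] [Fintype F] [CompatibleRing F]

open Classical in
/-- The realised label set `I(F; y)`. -/
noncomputable def realI (y : Fin Φ.k → F) : Finset (Fin Φ.e → F) :=
  univ.filter fun x => Φ.φI.Realize (Sum.elim x y)

open Classical in
/-- The realised blocks of a block formula. -/
noncomputable def realBlock (φ : Language.ring.Formula ((Fin Φ.e ⊕ Fin Φ.m) ⊕ Fin Φ.k))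
    (y : Fin Φ.k → F) (x : Fin Φ.e → F) : Finset (Fin Φ.m → F) :=
  univ.filter fun v => φ.Realize (Sum.elim (Sum.elim x v) y)

theorem mem_realI (y : Fin Φ.k → F) (x : Fin Φ.e → F) :
    x ∈ realI Φ F y ↔ Φ.φI.Realize (Sum.elim x y) := by
  classical
  simp [realI]

theorem mem_realBlock (φ : Language.ring.Formula ((Fin Φ.e ⊕ Fin Φ.m) ⊕ Fin Φ.k))
    (y : Fin Φ.k → F) (x : Fin Φ.e → F) (v : Fin Φ.m → F) :
    v ∈ realBlock Φ F φ y x ↔ φ.Realize (Sum.elim (Sum.elim x v) y) := by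
  classical
  simp [realBlock]

end Realised

/-- Piece 1 of the witness split: in every prime field of characteristic `≥ q₁` and for all
parameters, the realised family of `Φ` satisfies the pairwise clause. -/
def ClauseOK (Φ : Tuple) : Prop :=
  ∃ q₁ : ℕ, ∀ p : ℕ, p.Prime → q₁ ≤ p → ∀ hp : Fact p.Prime,
    letI := compatibleRingOfRing (ZMod p)
    ∀ y : Fin Φ.k → ZMod p,
      PairwiseClause (realI Φ (ZMod p) y) (realBlock Φ (ZMod p) Φ.φA y)
        (realBlock Φ (ZMod p) Φ.φB y) (realBlock Φ (ZMod p) Φ.φC y)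

/-- Piece 2 of the witness split: the exact-mass bound for the realised family of `Φ` in prime
fields of arbitrarily large characteristic, for some parameters. -/
def MassOK (Φ : Tuple) : Prop :=
  ∀ ε : ℝ, 0 < ε → ∃ η : ℝ, 0 < η ∧ ∀ q₀ : ℕ, ∃ p : ℕ, p.Prime ∧ q₀ ≤ p ∧ ∀ hp : Fact p.Prime,
    letI := compatibleRingOfRing (ZMod p)
    ∃ y : Fin Φ.k → ZMod p,
      (p : ℝ) ^ ((Φ.m : ℝ) + η) ≤
        ∑ x ∈ realI Φ (ZMod p) y,
          (((realBlock Φ (ZMod p) Φ.φA y x).card * (realBlock Φ (ZMod p) Φ.φB y x).card *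
              (realBlock Φ (ZMod p) Φ.φC y x).card : ℕ) : ℝ) ^ ((2 + ε) / 3)

/-- **Assembly of D-A (proved): `ClauseOK Φ → MassOK Φ → PairwiseCurvedTilingsLC`.** -/
theorem lc_of_witness (Φ : Tuple) (h₁ : ClauseOK Φ) (h₂ : MassOK Φ) : PairwiseCurvedTilingsLC := by
  obtain ⟨q₁, hclause⟩ := h₁
  refine ⟨Φ.e, Φ.m, Φ.k, Φ.φI, Φ.φA, Φ.φB, Φ.φC, fun ε hε => ?_⟩
  obtain ⟨η, hη, hmass⟩ := h₂ ε hε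
  refine ⟨η, hη, fun q₀ => ?_⟩
  obtain ⟨p, hp, hq, hy⟩ := hmass (max q₀ q₁)
  have hfact : Fact p.Prime := ⟨hp⟩
  obtain ⟨y, hy⟩ := hy hfact
  letI : CompatibleRing (ZMod p) := compatibleRingOfRing (ZMod p)
  refine ⟨ZMod p, inferInstance, inferInstance, compatibleRingOfRing (ZMod p), ?_, y,
    realI Φ (ZMod p) y, realBlock Φ (ZMod p) Φ.φA y, realBlock Φ (ZMod p) Φ.φB y,
    realBlock Φ (ZMod p) Φ.φC y, ?_, ?_, ?_, ?_, ?_, ?_⟩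
  · rw [ZMod.ringChar_zmod_n]; exact le_trans (le_max_left _ _) hq
  · intro x; exact mem_realI Φ (ZMod p) y x
  · intro x v; exact mem_realBlock Φ (ZMod p) Φ.φA y x v
  · intro x v; exact mem_realBlock Φ (ZMod p) Φ.φB y x v
  · intro x v; exact mem_realBlock Φ (ZMod p) Φ.φC y x v
  · exact hclause p hp (le_trans (le_max_right _ _) hq) hfact y
  · rw [ZMod.card p]; exact hy

/-- (d) for D-A: for EVERY tuple `Φ` one of the two pieces is refuted by the facts. -/
theorem witness_dead (Φ : Tuple) (hF : EtaleOpenFacts) : ¬ ClauseOK Φ ∨ ¬ MassOK Φ :=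
  no_redirect₂ (lc_of_witness Φ) hF

/-! ## §2 D-B — the PORE-SET split (gen-0 census §Decomposition D1, re-typed) -/

/-- `Sub₁ = PorosityCriterion` (combinatorics, true, M-sized): the pairwise clause is block TPP
plus three porous packings. -/
def PorosityCriterion : Prop :=
  ∀ (H : Type) [AddCommGroup H] [DecidableEq H] (ι : Type) (I : Finset ι) (A B C : ι → Finset H),
    PairwiseClause I A B C ↔
      ((∀ i ∈ I, ∀ s ∈ A i, ∀ s' ∈ A i, ∀ t ∈ B i, ∀ t' ∈ B i, ∀ u ∈ C i, ∀ u' ∈ C i,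
          (s' - s) + (t' - t) + (u' - u) = 0 → s = s' ∧ t = t' ∧ u = u') ∧
        (∀ i ∈ I, ∀ k ∈ I, i ≠ k → Disjoint ((A i - C i) + (B i - B i)) (A k - C k)) ∧
        (∀ i ∈ I, ∀ j ∈ I, i ≠ j → Disjoint ((A j - B j) + (C j - C j)) (A i - B i)) ∧
        (∀ i ∈ I, ∀ j ∈ I, i ≠ j → Disjoint ((B i - C i) + (A i - A i)) (B j - C j)))

/-- `Sub₂ = PorousDefinablePackingLC`: the crux with its clause replaced by block TPP + three
porous packings.  Same witnesses as the crux. -/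
def PorousDefinablePackingLC : Prop :=
  ∃ (e m k : ℕ) (φI : Language.ring.Formula (Fin e ⊕ Fin k))
    (φA φB φC : Language.ring.Formula ((Fin e ⊕ Fin m) ⊕ Fin k)),
    ∀ ε : ℝ, 0 < ε → ∃ η : ℝ, 0 < η ∧ ∀ q₀ : ℕ, ∃ (F : Type) (_ : Field F) (_ : Fintype F)
      (_ : CompatibleRing F) (_ : DecidableEq F), q₀ ≤ ringChar F ∧ ∃ (y : Fin k → F)
      (I : Finset (Fin e → F)) (A B C : (Fin e → F) → Finset (Fin m → F)),
      (∀ x, x ∈ I ↔ φI.Realize (Sum.elim x y)) ∧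
      (∀ x v, v ∈ A x ↔ φA.Realize (Sum.elim (Sum.elim x v) y)) ∧
      (∀ x v, v ∈ B x ↔ φB.Realize (Sum.elim (Sum.elim x v) y)) ∧
      (∀ x v, v ∈ C x ↔ φC.Realize (Sum.elim (Sum.elim x v) y)) ∧
      ((∀ i ∈ I, ∀ s ∈ A i, ∀ s' ∈ A i, ∀ t ∈ B i, ∀ t' ∈ B i, ∀ u ∈ C i, ∀ u' ∈ C i,
          (s' - s) + (t' - t) + (u' - u) = 0 → s = s' ∧ t = t' ∧ u = u') ∧
        (∀ i ∈ I, ∀ k ∈ I, i ≠ k → Disjoint ((A i - C i) + (B i - B i)) (A k - C k)) ∧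
        (∀ i ∈ I, ∀ j ∈ I, i ≠ j → Disjoint ((A j - B j) + (C j - C j)) (A i - B i)) ∧
        (∀ i ∈ I, ∀ j ∈ I, i ≠ j → Disjoint ((B i - C i) + (A i - A i)) (B j - C j))) ∧
      (Fintype.card F : ℝ) ^ ((m : ℝ) + η) ≤
        ∑ x ∈ I, (((A x).card * (B x).card * (C x).card : ℕ) : ℝ) ^ ((2 + ε) / 3)

/-- **Assembly of D-B (proved): `PorosityCriterion → PorousDefinablePackingLC → LC`.** -/
theorem LC_of_subs : PorosityCriterion → PorousDefinablePackingLC → PairwiseCurvedTilingsLC := by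
  rintro hcrit ⟨e, m, k, φI, φA, φB, φC, h⟩
  refine ⟨e, m, k, φI, φA, φB, φC, fun ε hε => ?_⟩
  obtain ⟨η, hη, hall⟩ := h ε hε
  refine ⟨η, hη, fun q₀ => ?_⟩
  obtain ⟨F, iF, iFin, iCR, iDE, hq, y, I, A, B, C, hI, hA, hB, hC, hpor, hmass⟩ := hall q₀
  have hpair : PairwiseClause I A B C := (hcrit (Fin m → F) (Fin e → F) I A B C).2 hpor
  exact ⟨F, iF, iFin, iCR, hq, y, I, A, B, C, hI, hA, hB, hC, hpair, hmass⟩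

/-- (d) for D-B: the facts refute a piece — and it is `Sub₂` (Sub₁ is a true lemma). -/
theorem poreSplit_dead (hF : EtaleOpenFacts) : ¬ PorosityCriterion ∨ ¬ PorousDefinablePackingLC :=
  no_redirect₂ LC_of_subs hF

/-! ## §3 D-C — the FAT bridge: `T = LCFat`, `T → LC` trivial, so (c) fails -/

/-- `LCFat`: the crux with the extra conjunct that every block is fat (`> K` in all three
colours) — by `not_PairwiseCurvedTilingsLC_thinBlocks` every witness is fat-dominated anyway. -/
def LCFat : Prop :=
  ∃ (K e m k : ℕ) (φI : Language.ring.Formula (Fin e ⊕ Fin k))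
    (φA φB φC : Language.ring.Formula ((Fin e ⊕ Fin m) ⊕ Fin k)),
    ∀ ε : ℝ, 0 < ε → ∃ η : ℝ, 0 < η ∧ ∀ q₀ : ℕ, ∃ (F : Type) (_ : Field F) (_ : Fintype F)
      (_ : CompatibleRing F), q₀ ≤ ringChar F ∧ ∃ (y : Fin k → F)
      (I : Finset (Fin e → F)) (A B C : (Fin e → F) → Finset (Fin m → F)),
      (∀ x, x ∈ I ↔ φI.Realize (Sum.elim x y)) ∧
      (∀ x v, v ∈ A x ↔ φA.Realize (Sum.elim (Sum.elim x v) y)) ∧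
      (∀ x v, v ∈ B x ↔ φB.Realize (Sum.elim (Sum.elim x v) y)) ∧
      (∀ x v, v ∈ C x ↔ φC.Realize (Sum.elim (Sum.elim x v) y)) ∧
      PairwiseClause I A B C ∧
      (Fintype.card F : ℝ) ^ ((m : ℝ) + η) ≤
        ∑ x ∈ I, (((A x).card * (B x).card * (C x).card : ℕ) : ℝ) ^ ((2 + ε) / 3) ∧
      (∀ x ∈ I, K < (A x).card ∧ K < (B x).card ∧ K < (C x).card)

/-- `LCFat → LC` (drop the conjunct): the bridge's implication piece is trivial, so its other
piece `LCFat` GIVES the crux on its own — (c) fails. -/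
theorem lc_of_LCFat : LCFat → PairwiseCurvedTilingsLC := by
  rintro ⟨K, e, m, k, φI, φA, φB, φC, h⟩
  refine ⟨e, m, k, φI, φA, φB, φC, fun ε hε => ?_⟩
  obtain ⟨η, hη, hall⟩ := h ε hε
  refine ⟨η, hη, fun q₀ => ?_⟩
  obtain ⟨F, iF, iFin, iCR, hq, y, I, A, B, C, hI, hA, hB, hC, hpair, hmass, -⟩ := hall q₀
  exact ⟨F, iF, iFin, iCR, hq, y, I, A, B, C, hI, hA, hB, hC, hpair, hmass⟩

theorem LCFat_dead (hF : EtaleOpenFacts) : ¬ LCFat :=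
  fun h => PairwiseCurvedTilingsLC_false_of_EtaleOpenFacts hF (lc_of_LCFat h)

/-! ## §4 D-D — the FACTS bridge: the only piece that could be "open" is `¬EtaleOpenFacts` -/

/-- Assembly of D-D (modus ponens). -/
theorem lc_of_notFacts (h₁ : ¬ EtaleOpenFacts) (h₂ : ¬ EtaleOpenFacts → PairwiseCurvedTilingsLC) :
    PairwiseCurvedTilingsLC :=
  h₂ h₁

/-- The crux IMPLIES the first piece (so it is necessary): `LC → ¬EtaleOpenFacts`. -/
theorem notFacts_of_lc (h : PairwiseCurvedTilingsLC) : ¬ EtaleOpenFacts :=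
  fun hF => PairwiseCurvedTilingsLC_false_of_EtaleOpenFacts hF h

/-! ## §5 D-E — the SHADOW bridge (sharpest necessary condition) -/

/-- `LC → ¬PorosityShadowBound` (contrapositive of k1's proved `notLC_of_shadowBound`). -/
theorem not_shadowBound_of_lc (h : PairwiseCurvedTilingsLC) : ¬ PorosityShadowBound :=
  fun hS => notLC_of_shadowBound hS h

/-- Assembly of D-E (modus ponens). -/
theorem lc_of_notShadow (h₁ : ¬ PorosityShadowBound)
    (h₂ : ¬ PorosityShadowBound → PairwiseCurvedTilingsLC) : PairwiseCurvedTilingsLC :=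
  h₂ h₁

/-- (d) for D-E: piece 1 is refuted by the facts (`porosityShadowBound_of_facts`, p150554). -/
theorem notShadow_dead (hF : EtaleOpenFacts) : ¬ ¬ PorosityShadowBound :=
  fun h => h (porosityShadowBound_of_facts hF.1 hF.2.1 hF.2.2)

/-! ## §6 D-F — the PATTERN bridge (clause weakened to the `i = j` pattern the kill uses) -/

/-- `LCPatternIJ`: the crux with the pairwise clause replaced by its `i = j` pattern alone
(block TPP + `A − C` packing + porosity along `B − B`). -/
def LCPatternIJ : Prop :=
  ∃ (e m k : ℕ) (φI : Language.ring.Formula (Fin e ⊕ Fin k))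
    (φA φB φC : Language.ring.Formula ((Fin e ⊕ Fin m) ⊕ Fin k)),
    ∀ ε : ℝ, 0 < ε → ∃ η : ℝ, 0 < η ∧ ∀ q₀ : ℕ, ∃ (F : Type) (_ : Field F) (_ : Fintype F)
      (_ : CompatibleRing F), q₀ ≤ ringChar F ∧ ∃ (y : Fin k → F)
      (I : Finset (Fin e → F)) (A B C : (Fin e → F) → Finset (Fin m → F)),
      (∀ x, x ∈ I ↔ φI.Realize (Sum.elim x y)) ∧
      (∀ x v, v ∈ A x ↔ φA.Realize (Sum.elim (Sum.elim x v) y)) ∧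
      (∀ x v, v ∈ B x ↔ φB.Realize (Sum.elim (Sum.elim x v) y)) ∧
      (∀ x v, v ∈ C x ↔ φC.Realize (Sum.elim (Sum.elim x v) y)) ∧
      PatternIJ I A B C ∧
      (Fintype.card F : ℝ) ^ ((m : ℝ) + η) ≤
        ∑ x ∈ I, (((A x).card * (B x).card * (C x).card : ℕ) : ℝ) ^ ((2 + ε) / 3)

/-- `LC → LCPatternIJ` (the piece is NECESSARY). -/
theorem lcPatternIJ_of_lc (h : PairwiseCurvedTilingsLC) : LCPatternIJ := by
  obtain ⟨e, m, k, φI, φA, φB, φC, h⟩ := h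
  refine ⟨e, m, k, φI, φA, φB, φC, fun ε hε => ?_⟩
  obtain ⟨η, hη, hall⟩ := h ε hε
  refine ⟨η, hη, fun q₀ => ?_⟩
  obtain ⟨F, iF, iFin, iCR, hq, y, I, A, B, C, hI, hA, hB, hC, hpair, hmass⟩ := hall q₀
  exact ⟨F, iF, iFin, iCR, hq, y, I, A, B, C, hI, hA, hB, hC, patternIJ_of_pairwise hpair, hmass⟩

/-- Assembly of D-F (modus ponens). -/
theorem lc_of_patternBridge (h₁ : LCPatternIJ) (h₂ : LCPatternIJ → PairwiseCurvedTilingsLC) :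
    PairwiseCurvedTilingsLC :=
  h₂ h₁

/-- (d) for D-F: the facts refute one of the two pieces (which one is open: see the census). -/
theorem patternBridge_dead (hF : EtaleOpenFacts) :
    ¬ LCPatternIJ ∨ ¬ (LCPatternIJ → PairwiseCurvedTilingsLC) :=
  no_redirect₂ (fun h₁ h₂ => lc_of_patternBridge h₁ h₂) hF

/-! ## §7 The seam is vacuous once the dodge is refuted (route fate) -/

/-- **The facts decide BOTH cruxes of the route**: the dodge NEGATIVELY
(`PairwiseCurvedTilingsLC_false_of_EtaleOpenFacts`, p150554) and the seam (vacuously) POSITIVELY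
(`HexagonClearanceR_of_definableTranslateRecurrenceLC`, p148553, fed by
`DefinableTranslateRecurrenceLC_of_facts`).  So `closes (h₁ : LC) (h₂ : R)` can never be applied:
the route ends on its negative side. -/
theorem facts_decide_route (hF : EtaleOpenFacts) :
    ¬ PairwiseCurvedTilingsLC ∧ HexagonClearanceR :=
  ⟨PairwiseCurvedTilingsLC_false_of_EtaleOpenFacts hF,
    Summit.MatrixMultiplication.MatrixMultiplication.Theorems.HexagonClearanceR.HexagonClearanceR_of_definableTranslateRecurrenceLC
      (DefinableTranslateRecurrenceLC_of_facts hF.1 hF.2.1 hF.2.2)⟩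

/-! ## §8 TIGHTNESS of the kill / status of D-F's first piece: the `i = j` pattern ALONE admits
exact-mass definable families (the SPHERE family), so `LCPatternIJ` is TRUE and the bridge piece
`LCPatternIJ → LC` is the crux again.

Family (m = 3, labels e = 3, no parameters; fields `F` with `−1` a non-square, e.g. `𝔽_p`,
`p ≡ 3 (mod 4)`, `p → ∞`): `I = {u ∈ F³ : u·u = 1}` (|I| = p² − p), `A_u = {u}`, `B_u = u^⊥`
(|B_u| = p²), `C_u = {0}`.  Pattern `i = j` holds (`sphere_patternIJ`, kernel-checked below: it
reduces to the ANISOTROPY of `x² + y² + z²` on `i^⊥`, proved with cross products), and the mass is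
`Σ_u (1·p²·1)^{(2+ε)/3} = (p² − p)·p^{(4+2ε)/3} ≥ ½·p^{3 + 1/3 + 2ε/3} > p^{m + 1/3}` — toy check
`sphere_check.py` (p = 7, 11, 19, 23: 0 violations, log_p mass ≈ 3.26–3.65; p = 13, 17: thousands
of violations, as predicted).  The family violates the other two 2-label patterns grossly
(`Σ_u |A_u||B_u| = p⁴ > p³`), which is exactly the input (`three packings + AM–GM`) that
`notLC_of_shadowBound` adds to the topological step: the negative lemma is FALSE WITHOUT the
`A−B` / `B−C` packings. -/

section Sphere

open Matrix

/-- Anisotropy of `x² + y² + z²` on the orthogonal complement of a unit vector, over a field in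
which `−1` is not a square: `i·i = 1`, `w·w = 0`, `i·w = 0 ⇒ w = 0`.  (Cross-product proof:
`w ⨯ (i ⨯ w) = 0` makes `i ⨯ w = a•w`, and `i ⨯ (i ⨯ w) = −w` gives `(a² + 1)•w = 0`.) -/
theorem perp_anisotropic {F : Type*} [Field F] (hF : ¬ IsSquare (-1 : F)) {i w : Fin 3 → F}
    (hi : i ⬝ᵥ i = 1) (hw : w ⬝ᵥ w = 0) (hiw : i ⬝ᵥ w = 0) : w = 0 := by
  by_contra hw0
  have h2 : i ⨯₃ (i ⨯₃ w) = -w := by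
    rw [cross_cross_eq_smul_sub_smul', hiw, hi, zero_smul, one_smul, zero_sub]
  have h3 : w ⨯₃ (i ⨯₃ w) = 0 := by
    rw [cross_cross_eq_smul_sub_smul', hw, hiw, zero_smul, zero_smul, sub_zero]
  have hdep : ¬ LinearIndependent F ![w, i ⨯₃ w] := fun hli =>
    (crossProduct_ne_zero_iff_linearIndependent.2 hli) h3
  rw [LinearIndependent.pair_iff' hw0] at hdep
  simp only [not_forall, not_not] at hdep
  obtain ⟨a, ha⟩ := hdep
  have h4 : i ⨯₃ (i ⨯₃ w) = (a * a) • w := by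
    calc i ⨯₃ (i ⨯₃ w) = i ⨯₃ (a • w) := by rw [ha]
      _ = a • (i ⨯₃ w) := LinearMap.map_smul _ _ _
      _ = a • (a • w) := by rw [ha]
      _ = (a * a) • w := smul_smul _ _ _
  have h5 : (a * a + 1) • w = 0 := by
    rw [add_smul, one_smul, ← h4, h2, neg_add_cancel]
  have h6 : a * a + 1 = 0 := by
    rcases smul_eq_zero.1 h5 with h | h
    · exact h
    · exact absurd h hw0
  exact hF ⟨a, by linear_combination -h6⟩

/-- **The sphere family satisfies the `i = j` pattern** (block TPP + `A − C` packing + porosity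
along `B − B`) whenever `−1` is a non-square in `F`. -/
theorem sphere_patternIJ {F : Type*} [Field F] [Fintype F] [DecidableEq F]
    (hF : ¬ IsSquare (-1 : F)) :
    PatternIJ (univ.filter fun u : Fin 3 → F => u ⬝ᵥ u = 1) (fun u => ({u} : Finset (Fin 3 → F)))
      (fun u => univ.filter fun v : Fin 3 → F => u ⬝ᵥ v = 0) (fun _ => ({0} : Finset (Fin 3 → F))) := by
  intro i hi k hk s hs s' hs' t ht t' ht' u hu u' hu' h0
  simp only [mem_filter, mem_univ, true_and, mem_singleton] at hi hk hs hs' ht ht' hu hu'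
  subst s
  subst s'
  subst u
  subst u'
  -- now `s = k`, `s' = i`, `u = u' = 0`; goal `i = k ∧ k = i ∧ t = t' ∧ 0 = 0`
  have hw : t' - t = k - i := by
    have h0' := h0
    rw [sub_self, add_zero] at h0'
    linear_combination h0'
  have hiw : i ⬝ᵥ (k - i) = 0 := by rw [← hw, dotProduct_sub, ht, ht', sub_self]
  have hik : i ⬝ᵥ k = 1 := by
    have h := hiw
    rw [dotProduct_sub, hi] at h
    linear_combination h
  have hww : (k - i) ⬝ᵥ (k - i) = 0 := by
    rw [sub_dotProduct, dotProduct_sub, dotProduct_sub, hk, hi, dotProduct_comm k i, hik]; ring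
  have hki : k - i = 0 := perp_anisotropic hF hi hww hiw
  have hik' : i = k := (sub_eq_zero.1 hki).symm
  refine ⟨hik', hik'.symm, ?_, rfl⟩
  have htt : t' - t = 0 := by rw [hw, hki]
  exact (sub_eq_zero.1 htt).symm

/-- The prime fields the family lives in: `p ≡ 3 (mod 4)` (then `−1` is a non-square,
`ZMod.exists_sq_eq_neg_one_iff`); there are infinitely many such primes
(`Nat.infinite_setOf_prime_modEq_…` / Dirichlet), so fields of arbitrarily large characteristic. -/
theorem sphere_patternIJ_zmod (p : ℕ) [Fact p.Prime] (hp : p % 4 = 3) :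
    PatternIJ (univ.filter fun u : Fin 3 → ZMod p => u ⬝ᵥ u = 1)
      (fun u => ({u} : Finset (Fin 3 → ZMod p)))
      (fun u => univ.filter fun v : Fin 3 → ZMod p => u ⬝ᵥ v = 0)
      (fun _ => ({0} : Finset (Fin 3 → ZMod p))) :=
  sphere_patternIJ fun h => ZMod.exists_sq_eq_neg_one_iff.1 h hp

end Sphere

/-! ## §9 `LCPatternIJ` HOLDS — the sphere family in full (formulas, counting, Dirichlet)

`lcPatternIJ_holds : LCPatternIJ`: D-F's first piece is a THEOREM, so its bridge piece
`LCPatternIJ → LC` carries the whole (refuted) crux. -/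

section SphereLC

open Matrix

/-- `Σ_l v(a l)·v(b l) = c` is definable (one atomic formula). -/
theorem definable_dot_eq {α : Type} (a b : Fin 3 → α) (c : Language.ring.Term α) :
    ∃ θ : Language.ring.Formula α, ∀ (K : Type) [Field K] [CompatibleRing K] (v : α → K),
      θ.Realize v ↔ ∑ l, v (a l) * v (b l) = c.realize v := by
  obtain ⟨s, hs⟩ := Literature.ModelTheory.PseudofiniteFields.exists_term_realize_sum (fun l => Term.var (a l) * Term.var (b l))
  refine ⟨Term.equal s c, fun K _ _ v => ?_⟩
  simp only [Formula.realize_equal, hs, realize_mul, Term.realize_var]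

theorem exists_phiI : ∃ φI : Language.ring.Formula (Fin 3 ⊕ Fin 0),
    ∀ (K : Type) [Field K] [CompatibleRing K] (w : Fin 3 ⊕ Fin 0 → K),
      φI.Realize w ↔ ∑ l, w (Sum.inl l) * w (Sum.inl l) = 1 := by
  obtain ⟨θ, hθ⟩ := definable_dot_eq (α := Fin 3 ⊕ Fin 0) Sum.inl Sum.inl 1
  exact ⟨θ, fun K _ _ w => by rw [hθ, realize_one]⟩

theorem exists_phiA : ∃ φA : Language.ring.Formula ((Fin 3 ⊕ Fin 3) ⊕ Fin 0),
    ∀ (K : Type) [Field K] [CompatibleRing K] (w : (Fin 3 ⊕ Fin 3) ⊕ Fin 0 → K),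
      φA.Realize w ↔ (fun l => w (Sum.inl (Sum.inr l))) = fun l => w (Sum.inl (Sum.inl l)) :=
  Literature.ModelTheory.PseudofiniteFields.definable_vecEq (fun l => Sum.inl (Sum.inr l)) (fun l => Sum.inl (Sum.inl l))

theorem exists_phiB : ∃ φB : Language.ring.Formula ((Fin 3 ⊕ Fin 3) ⊕ Fin 0),
    ∀ (K : Type) [Field K] [CompatibleRing K] (w : (Fin 3 ⊕ Fin 3) ⊕ Fin 0 → K),
      φB.Realize w ↔ ∑ l, w (Sum.inl (Sum.inl l)) * w (Sum.inl (Sum.inr l)) = 0 := by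
  obtain ⟨θ, hθ⟩ := definable_dot_eq (α := (Fin 3 ⊕ Fin 3) ⊕ Fin 0)
    (fun l => Sum.inl (Sum.inl l)) (fun l => Sum.inl (Sum.inr l)) 0
  exact ⟨θ, fun K _ _ w => by rw [hθ, realize_zero]⟩

theorem exists_phiC : ∃ φC : Language.ring.Formula ((Fin 3 ⊕ Fin 3) ⊕ Fin 0),
    ∀ (K : Type) [Field K] [CompatibleRing K] (w : (Fin 3 ⊕ Fin 3) ⊕ Fin 0 → K),
      φC.Realize w ↔ ∀ l : Fin 3, w (Sum.inl (Sum.inr l)) = 0 := by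
  refine Literature.ModelTheory.PseudofiniteFields.definable_iInf fun l => ?_
  obtain ⟨θ, hθ⟩ := Literature.ModelTheory.PseudofiniteFields.definable_termEq (α := (Fin 3 ⊕ Fin 3) ⊕ Fin 0) (Term.var (Sum.inl (Sum.inr l))) 0
  exact ⟨θ, fun K _ _ w => by rw [hθ, Term.realize_var, realize_zero]⟩

/-- `|u^⊥| = |F|²` for a unit vector `u` (rank–nullity). -/
theorem card_perp {F : Type*} [Field F] [Fintype F] [DecidableEq F] {x : Fin 3 → F}
    (hx : x ⬝ᵥ x = 1) :
    (univ.filter fun v : Fin 3 → F => x ⬝ᵥ v = 0).card = Fintype.card F ^ 2 := by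
  classical
  let f : (Fin 3 → F) →ₗ[F] F :=
    { toFun := fun v => x ⬝ᵥ v
      map_add' := fun v w => dotProduct_add x v w
      map_smul' := fun c v => by rw [dotProduct_smul, RingHom.id_apply] }
  have hf : ∀ v, f v = x ⬝ᵥ v := fun v => rfl
  have hsurj : Function.Surjective f := fun c =>
    ⟨c • x, by rw [hf, dotProduct_smul, hx, smul_eq_mul, mul_one]⟩
  have hrange : Module.finrank F (LinearMap.range f) = 1 := by
    rw [LinearMap.range_eq_top.2 hsurj, finrank_top, Module.finrank_self]
  have hker : Module.finrank F (LinearMap.ker f) = 2 := by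
    have h := f.finrank_range_add_finrank_ker
    rw [hrange, Module.finrank_fin_fun] at h
    omega
  have hcard : Fintype.card (LinearMap.ker f) = Fintype.card F ^ 2 := by
    rw [Module.card_eq_pow_finrank (K := F) (V := LinearMap.ker f), hker]
  rw [← hcard, Fintype.card_congr (Equiv.subtypeEquivRight
    (fun v => (LinearMap.mem_ker (f := f) (y := v)).trans (by rw [hf])) :
      (LinearMap.ker f) ≃ {v : Fin 3 → F // x ⬝ᵥ v = 0}), Fintype.card_subtype]

/-- `{b : b² = c}` has at most two elements in a field. -/
theorem card_sq_eq_le_two {F : Type*} [Field F] [Fintype F] [DecidableEq F] (c : F) :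
    (univ.filter fun b : F => b ^ 2 = c).card ≤ 2 := by
  by_cases h : ∃ b₀, b₀ ^ 2 = c
  · obtain ⟨b₀, hb₀⟩ := h
    calc (univ.filter fun b : F => b ^ 2 = c).card ≤ ({b₀, -b₀} : Finset F).card := by
          refine card_le_card fun b hb => ?_
          rw [mem_filter] at hb
          have hbb : b ^ 2 = b₀ ^ 2 := by rw [hb.2, hb₀]
          rcases sq_eq_sq_iff_eq_or_eq_neg.1 hbb with h1 | h1
          · simp [h1]
          · simp [h1]
      _ ≤ 2 := card_le_two
  · have : (univ.filter fun b : F => b ^ 2 = c) = ∅ := by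
      refine filter_eq_empty_iff.2 fun b _ hb => h ⟨b, hb⟩
    rw [this, Finset.card_empty]; exact Nat.zero_le _

/-- The exceptional set of the stereographic parametrisation, `{(a,b) : a² + b² + 1 = 0}`, has at
most `2|F|` points. -/
theorem card_excep_le {F : Type*} [Field F] [Fintype F] [DecidableEq F] :
    (univ.filter fun ab : F × F => ab.1 ^ 2 + ab.2 ^ 2 + 1 = 0).card ≤ 2 * Fintype.card F := by
  calc (univ.filter fun ab : F × F => ab.1 ^ 2 + ab.2 ^ 2 + 1 = 0).card
      ≤ ((univ : Finset F).biUnion fun a =>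
          ({a} : Finset F) ×ˢ (univ.filter fun b : F => b ^ 2 = -1 - a ^ 2)).card := by
        refine card_le_card fun ab hab => ?_
        rw [mem_filter] at hab
        rw [mem_biUnion]
        refine ⟨ab.1, mem_univ _, ?_⟩
        rw [mem_product, mem_singleton, mem_filter]
        exact ⟨rfl, mem_univ _, by linear_combination hab.2⟩
    _ ≤ ∑ a : F, (({a} : Finset F) ×ˢ (univ.filter fun b : F => b ^ 2 = -1 - a ^ 2)).card :=
        card_biUnion_le
    _ ≤ ∑ _a : F, 2 := by
        refine sum_le_sum fun a _ => ?_
        rw [card_product, card_singleton, one_mul]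
        exact card_sq_eq_le_two _
    _ = 2 * Fintype.card F := by rw [sum_const, card_univ, smul_eq_mul, mul_comm]

/-- Stereographic lower bound for the unit sphere: `|{u ∈ F³ : u·u = 1}| ≥ |F|² − 2|F|`
(characteristic `≠ 2`). -/
theorem card_sphere_ge {F : Type*} [Field F] [Fintype F] [DecidableEq F] (h2 : (2 : F) ≠ 0) :
    Fintype.card F ^ 2 - 2 * Fintype.card F ≤
      (univ.filter fun u : Fin 3 → F => u ⬝ᵥ u = 1).card := by
  classical
  set D := (univ.filter fun ab : F × F => ab.1 ^ 2 + ab.2 ^ 2 + 1 ≠ 0) with hD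
  set s : F × F → (Fin 3 → F) := fun ab =>
    ![2 * ab.1 / (ab.1 ^ 2 + ab.2 ^ 2 + 1), 2 * ab.2 / (ab.1 ^ 2 + ab.2 ^ 2 + 1),
      (ab.1 ^ 2 + ab.2 ^ 2 - 1) / (ab.1 ^ 2 + ab.2 ^ 2 + 1)] with hs
  have hDcard : Fintype.card F ^ 2 - 2 * Fintype.card F ≤ D.card := by
    have hsum := card_filter_add_card_filter_not (s := (univ : Finset (F × F)))
      (p := fun ab : F × F => ab.1 ^ 2 + ab.2 ^ 2 + 1 = 0)
    have hE := card_excep_le (F := F)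
    have huniv : (univ : Finset (F × F)).card = Fintype.card F ^ 2 := by
      rw [card_univ, Fintype.card_prod, sq]
    rw [huniv] at hsum
    have : D = univ.filter fun ab : F × F => ¬ (ab.1 ^ 2 + ab.2 ^ 2 + 1 = 0) := rfl
    rw [this]
    omega
  refine le_trans hDcard (card_le_card_of_injOn s (fun ab hab => ?_) ?_)
  · -- lands on the sphere
    rw [hD, mem_coe, mem_filter] at hab
    have hN : ab.1 ^ 2 + ab.2 ^ 2 + 1 ≠ 0 := hab.2
    rw [mem_coe, mem_filter]
    refine ⟨mem_univ _, ?_⟩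
    simp only [hs, dotProduct, Fin.sum_univ_three, Matrix.cons_val_zero, Matrix.cons_val_one,
      Matrix.cons_val]
    field_simp
    ring
  · -- injective on D
    intro ab hab ab' hab' heq
    rw [hD, mem_coe, mem_filter] at hab hab'
    have hN : ab.1 ^ 2 + ab.2 ^ 2 + 1 ≠ 0 := hab.2
    have hN' : ab'.1 ^ 2 + ab'.2 ^ 2 + 1 ≠ 0 := hab'.2
    have h0 := congrFun heq 0
    have h1 := congrFun heq 1
    have h3 := congrFun heq 2
    simp only [hs, Matrix.cons_val_zero, Matrix.cons_val_one, Matrix.cons_val] at h0 h1 h3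
    -- from the third coordinates: the denominators agree
    have hNN : ab.1 ^ 2 + ab.2 ^ 2 + 1 = ab'.1 ^ 2 + ab'.2 ^ 2 + 1 := by
      rw [div_eq_div_iff hN hN'] at h3
      have h4 : (2 : F) * (ab.1 ^ 2 + ab.2 ^ 2 + 1) = 2 * (ab'.1 ^ 2 + ab'.2 ^ 2 + 1) := by
        linear_combination h3
      exact mul_left_cancel₀ h2 h4
    rw [hNN] at h0 h1
    rw [div_left_inj' hN'] at h0 h1
    have ha : ab.1 = ab'.1 := mul_left_cancel₀ h2 h0
    have hb : ab.2 = ab'.2 := mul_left_cancel₀ h2 h1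
    exact Prod.ext ha hb

/-- `3 : ZMod 4` is a unit (`3·3 = 1`). -/
theorem isUnit_three_zmod_four : IsUnit (3 : ZMod 4) :=
  ⟨⟨3, 3, by decide, by decide⟩, rfl⟩

/-- **`LCPatternIJ` holds**: the sphere family over `𝔽_p`, `p ≡ 3 (mod 4)` (Dirichlet), with
`η = 1/6` for every `ε`. -/
theorem lcPatternIJ_holds : LCPatternIJ := by
  obtain ⟨φI, hφI⟩ := exists_phiI
  obtain ⟨φA, hφA⟩ := exists_phiA
  obtain ⟨φB, hφB⟩ := exists_phiB
  obtain ⟨φC, hφC⟩ := exists_phiC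
  refine ⟨3, 3, 0, φI, φA, φB, φC, fun ε hε => ⟨1 / 6, by norm_num, fun q₀ => ?_⟩⟩
  obtain ⟨p, hpgt, hp, hpmod⟩ :=
    Nat.forall_exists_prime_gt_and_eq_mod isUnit_three_zmod_four (max q₀ 64)
  haveI : Fact p.Prime := ⟨hp⟩
  have hp4 : p % 4 = 3 := by
    have h := congrArg ZMod.val hpmod
    rw [ZMod.val_natCast] at h
    have h3 : (3 : ZMod 4).val = 3 := by decide
    omega
  have hq₀ : q₀ < p := lt_of_le_of_lt (le_max_left _ _) hpgt
  have h64 : 64 < p := lt_of_le_of_lt (le_max_right _ _) hpgt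
  have h2 : (2 : ZMod p) ≠ 0 := by
    intro h
    have hdvd : p ∣ 2 := (ZMod.natCast_eq_zero_iff 2 p).1 (by exact_mod_cast h)
    have := Nat.le_of_dvd two_pos hdvd
    omega
  letI : CompatibleRing (ZMod p) := compatibleRingOfRing (ZMod p)
  refine ⟨ZMod p, inferInstance, inferInstance, compatibleRingOfRing (ZMod p), ?_, Fin.elim0,
    univ.filter (fun u : Fin 3 → ZMod p => u ⬝ᵥ u = 1), fun u => ({u} : Finset (Fin 3 → ZMod p)),
    fun u => univ.filter (fun v : Fin 3 → ZMod p => u ⬝ᵥ v = 0),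
    fun _ => ({0} : Finset (Fin 3 → ZMod p)), ?_, ?_, ?_, ?_, sphere_patternIJ_zmod p hp4, ?_⟩
  · rw [ZMod.ringChar_zmod_n]; exact hq₀.le
  · intro x
    rw [mem_filter, hφI]
    simp [dotProduct]
  · intro x v
    rw [mem_singleton, hφA]
    simp [funext_iff]
  · intro x v
    rw [mem_filter, hφB]
    simp [dotProduct]
  · intro x v
    rw [mem_singleton, hφC]
    simp [funext_iff]
  · -- the mass: |I| · (p²)^{(2+ε)/3} ≥ (p²/2)·p^{4/3} ≥ p^{19/6}
    set I := univ.filter (fun u : Fin 3 → ZMod p => u ⬝ᵥ u = 1) with hI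
    have hterm : ∀ x ∈ I, (((({x} : Finset (Fin 3 → ZMod p)).card *
        (univ.filter fun v : Fin 3 → ZMod p => x ⬝ᵥ v = 0).card *
        ({0} : Finset (Fin 3 → ZMod p)).card : ℕ) : ℝ) ^ ((2 + ε) / 3))
        = ((p : ℝ) ^ 2) ^ ((2 + ε) / 3) := by
      intro x hx
      rw [hI, mem_filter] at hx
      rw [card_singleton, card_singleton, card_perp hx.2, ZMod.card, one_mul, mul_one]
      push_cast
      rfl
    rw [Finset.sum_congr rfl hterm, sum_const, nsmul_eq_mul, ZMod.card]
    have hP : (64 : ℝ) < p := by exact_mod_cast h64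
    have hP0 : (0 : ℝ) < p := by linarith
    have hIcard : (p : ℝ) ^ 2 / 2 ≤ (I.card : ℝ) := by
      have h := card_sphere_ge (F := ZMod p) h2
      rw [ZMod.card] at h
      have h1 : p ^ 2 ≤ I.card + 2 * p := Nat.sub_le_iff_le_add.1 h
      have h1' : (p : ℝ) ^ 2 ≤ (I.card : ℝ) + 2 * p := by exact_mod_cast h1
      have h3 : 2 * (p : ℝ) ≤ (p : ℝ) ^ 2 / 2 := by nlinarith
      linarith
    have hexp : ((p : ℝ) ^ 2) ^ ((2 : ℝ) / 3) ≤ ((p : ℝ) ^ 2) ^ ((2 + ε) / 3) :=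
      Real.rpow_le_rpow_of_exponent_le (by nlinarith) (by linarith)
    have h43 : ((p : ℝ) ^ 2) ^ ((2 : ℝ) / 3) = (p : ℝ) ^ ((4 : ℝ) / 3) := by
      rw [← Real.rpow_natCast (p : ℝ) 2, ← Real.rpow_mul hP0.le]
      norm_num
    have h16 : (2 : ℝ) ≤ (p : ℝ) ^ ((1 : ℝ) / 6) := by
      have h64' : (2 : ℝ) = (64 : ℝ) ^ ((1 : ℝ) / 6) := by
        rw [show (64 : ℝ) = (2 : ℝ) ^ ((6 : ℕ) : ℝ) by norm_num, ← Real.rpow_mul (by norm_num)]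
        norm_num
      rw [h64']
      exact Real.rpow_le_rpow (by norm_num) hP.le (by norm_num)
    have hA : (p : ℝ) ^ ((19 : ℝ) / 6) * (p : ℝ) ^ ((1 : ℝ) / 6) =
        (p : ℝ) ^ 2 * (p : ℝ) ^ ((4 : ℝ) / 3) := by
      rw [← Real.rpow_add hP0, ← Real.rpow_natCast (p : ℝ) 2, ← Real.rpow_add hP0]
      norm_num
    have hgoal : (p : ℝ) ^ (((3 : ℕ) : ℝ) + 1 / 6) = (p : ℝ) ^ ((19 : ℝ) / 6) := by norm_num
    rw [hgoal]
    have hpos1 : 0 ≤ (p : ℝ) ^ ((19 : ℝ) / 6) := by positivity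
    have hB : (p : ℝ) ^ ((19 : ℝ) / 6) * 2 ≤ (p : ℝ) ^ 2 * (p : ℝ) ^ ((4 : ℝ) / 3) := by
      rw [← hA]
      exact mul_le_mul_of_nonneg_left h16 hpos1
    have hC : (p : ℝ) ^ 2 / 2 * ((p : ℝ) ^ 2) ^ ((2 : ℝ) / 3) ≤
        (I.card : ℝ) * ((p : ℝ) ^ 2) ^ ((2 + ε) / 3) :=
      mul_le_mul hIcard hexp (by positivity) (by positivity)
    rw [h43] at hC
    linarith

/-- **D-F's bridge piece is the crux again and is refuted by the facts**: since `LCPatternIJ` is a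
theorem, `LCPatternIJ → LC` is (conditionally) FALSE. -/
theorem patternBridge_piece_dead (hF : EtaleOpenFacts) :
    ¬ (LCPatternIJ → PairwiseCurvedTilingsLC) :=
  fun h => PairwiseCurvedTilingsLC_false_of_EtaleOpenFacts hF (h lcPatternIJ_holds)

/-- **Tightness of the negative lemma** (unconditional): no hypothesis consistent with the tree
can refute the ONE-PATTERN version of the crux — in particular the kill `EtaleOpenFacts → ¬LC`
genuinely uses the other two 2-label patterns (the `A−B`/`B−C` packings in the AM–GM step of
`notLC_of_shadowBound`). -/
theorem onePattern_version_unrefutable {H : Prop} (hkill : H → ¬ LCPatternIJ) : ¬ H :=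
  fun h => hkill h lcPatternIJ_holds

end SphereLC

end Summit.MatrixMultiplication.MatrixMultiplication.Cruxes.PairwiseCurvedTilingsLC.StrategyCensusR1
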